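import Literature.Geometry.Kaehler.ComplexTorusCastelnuovoSeveri
import HarnessLib

/-!
# The intersection form of `X₁ × X₂` (two polarised one-dimensional complex tori) is negative definite on the
# real `(1,1)`-classes orthogonal to the fibre classes `F₁`, `F₂` (Castelnuovo–Severi / Hodge index)

Layer `Literature/Geometry/Kaehler`, namespace `Literature.Geometry.Kaehler.ComplexTorus`; lane
`lit-hodgefound` (Track 2 foundations library), Layer A4 (programme Q58 of
`run/shared/lean/pub/lit-hodgefound/SKELETON.md`; prover seat `lit-hodgefound-p07`, generation 11, leaf (xlviii)).
Sequel of `ComplexTorusCastelnuovoSeveri.lean` (leaf (xlvi): `(T · T)(F₁ · F₂) ≤ 2(T · F₁)(T · F₂)`, equality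
iff `T = c₁F₁ + c₂F₂`).

Sources. W. Fulton, *Intersection Theory* (2nd ed. 1998), §16.1 Example 16.1.10 (a), (b) [held text
`book:fultonnd-intersection-theory` p0299 L24–L33] ("`Q(T) = nn' - ½(T · T)` … `q` is a non-negative quadratic
form"); R. Hartshorne, *Algebraic Geometry*, Ch. V Thm. 1.9 (Hodge index theorem: "if `D · H = 0` then `D² ≤ 0`",
Rem. 1.9.1: the intersection form on `Num(X) ⊗ ℝ` has signature `(1, ρ - 1)`; Ex. 1.9). Read on the product
`X₁ × X₂` of two polarised ONE-DIMENSIONAL complex tori with the fibre (Kähler) classes `F₁ = p₁^*(-ω₁)`,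
`F₂ = p₂^*(-ω₂)` spanning a hyperbolic plane (`F₁² = F₂² = 0`, `F₁ · F₂ > 0`), for REAL `(1,1)`-classes `T`
with `(A · B) = Re ∫ A_ℂ ∧ B_ℂ`:

* **`re_torusIntegral_wedge_self_nonpos_of_orthogonal`**: `T · F₁ = T · F₂ = 0 ⟹ (T · T) ≤ 0`;
* **`eq_zero_of_orthogonal_of_wedge_self_eq_zero`**: `T · F₁ = T · F₂ = 0` and `(T · T) = 0 ⟹ T = 0`;
* **`re_torusIntegral_wedge_self_neg_of_orthogonal`**: `T ≠ 0`, `T · F₁ = T · F₂ = 0 ⟹ (T · T) < 0`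
  (the intersection form is NEGATIVE DEFINITE on `⟨F₁, F₂⟩^⊥`).

## Contents (theorems only; NO definition, NO named fact, net debt 0)

## References

* [Fulton1998] W. Fulton, *Intersection Theory*, 2nd ed., Springer (1998), §16.1 Example 16.1.10 (a), (b) (p. 299).
* [Hartshorne1977] R. Hartshorne, *Algebraic Geometry*, Ch. V Thm. 1.9, Rem. 1.9.1, Ex. 1.9.
-/

noncomputable section

open scoped Manifold ComplexOrder
open Set Function Complex Finset Module
open Literature.LinearAlgebra.Alternating Literature.Analysis.Complex

namespace Literature.Geometry.Kaehler

namespace ComplexTorus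

section NegativeDefinite

variable {ι₁ ι₂ : Type*} [Fintype ι₁] [Fintype ι₂] [DecidableEq ι₁] [DecidableEq ι₂]
  {E₁ E₂ : Type*} [NormedAddCommGroup E₁] [NormedSpace ℂ E₁] [NormedAddCommGroup E₂] [NormedSpace ℂ E₂]
  [FiniteDimensional ℂ E₁] [FiniteDimensional ℂ E₂]
  (Φ₁ : (ι₁ → ℝ) ≃L[ℝ] E₁) (Φ₂ : (ι₂ → ℝ) ≃L[ℝ] E₂) (e : Fin (2 * 2) ≃ ι₁ ⊕ ι₂) (f₁ : Fin 2 ≃ ι₁) (f₂ : Fin 2 ≃ ι₂)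
  {ω₁ : E₁ [⋀^Fin 2]→L[ℝ] ℝ} {ω₂ : E₂ [⋀^Fin 2]→L[ℝ] ℝ}

include f₁ f₂ in
/-- **Hodge index on `X₁ × X₂`: a real `(1,1)`-class orthogonal to both fibre classes has `(T · T) ≤ 0`**
(`D · H = 0 ⟹ D² ≤ 0` for `H = F₁ + F₂`; here from the Castelnuovo–Severi inequality
`(T · T)(F₁ · F₂) ≤ 2(T · F₁)(T · F₂) = 0` and `F₁ · F₂ > 0`).
[cite: Hartshorne1977, Ch. V Thm. 1.9] [cite: Fulton1998, §16.1 Example 16.1.10 (a) (p. 299)] -/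
theorem re_torusIntegral_wedge_self_nonpos_of_orthogonal (h₁ : IsRiemannForm Φ₁ ω₁) (h₂ : IsRiemannForm Φ₂ ω₂)
    {T : (E₁ × E₂) [⋀^Fin 2]→L[ℝ] ℝ} (hT : ∀ u v : E₁ × E₂, T ![I • u, I • v] = T ![u, v])
    (hT₁ : (torusIntegral (prodPeriod Φ₁ Φ₂) e ((ofRealForm T).wedge
      (ofRealForm ((-ω₁).compContinuousLinearMap (ContinuousLinearMap.fst ℝ E₁ E₂))))).re = 0)
    (hT₂ : (torusIntegral (prodPeriod Φ₁ Φ₂) e ((ofRealForm T).wedge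
      (ofRealForm ((-ω₂).compContinuousLinearMap (ContinuousLinearMap.snd ℝ E₁ E₂))))).re = 0) :
    (torusIntegral (prodPeriod Φ₁ Φ₂) e ((ofRealForm T).wedge (ofRealForm T))).re ≤ 0 := by
  have hCS := castelnuovoSeveri Φ₁ Φ₂ e f₁ f₂ h₁ h₂ hT
  have hδ := castelnuovoSeveri_pos Φ₁ Φ₂ e f₁ f₂ h₁ h₂
  rw [hT₁, hT₂, mul_zero] at hCS
  exact nonpos_of_mul_nonpos_left hCS hδ

include f₁ f₂ in
/-- **… and `(T · T) = 0` only for `T = 0`**: the equality case of Castelnuovo–Severi gives `T = c₁F₁ + c₂F₂`,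
and `T · F₁ = c₂(F₁ · F₂) = 0`, `T · F₂ = c₁(F₁ · F₂) = 0` force `c₁ = c₂ = 0`.
[cite: Hartshorne1977, Ch. V Thm. 1.9 and Rem. 1.9.1] [cite: Fulton1998, §16.1 Example 16.1.10 (a) (p. 299)] -/
theorem eq_zero_of_orthogonal_of_wedge_self_eq_zero (h₁ : IsRiemannForm Φ₁ ω₁) (h₂ : IsRiemannForm Φ₂ ω₂)
    {T : (E₁ × E₂) [⋀^Fin 2]→L[ℝ] ℝ} (hT : ∀ u v : E₁ × E₂, T ![I • u, I • v] = T ![u, v])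
    (hT₁ : (torusIntegral (prodPeriod Φ₁ Φ₂) e ((ofRealForm T).wedge
      (ofRealForm ((-ω₁).compContinuousLinearMap (ContinuousLinearMap.fst ℝ E₁ E₂))))).re = 0)
    (hT₂ : (torusIntegral (prodPeriod Φ₁ Φ₂) e ((ofRealForm T).wedge
      (ofRealForm ((-ω₂).compContinuousLinearMap (ContinuousLinearMap.snd ℝ E₁ E₂))))).re = 0)
    (hT0 : (torusIntegral (prodPeriod Φ₁ Φ₂) e ((ofRealForm T).wedge (ofRealForm T))).re = 0) : T = 0 := by
  set P₁ : (E₁ × E₂) [⋀^Fin 2]→L[ℝ] ℝ := (-ω₁).compContinuousLinearMap (ContinuousLinearMap.fst ℝ E₁ E₂) with hP₁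
  set P₂ : (E₁ × E₂) [⋀^Fin 2]→L[ℝ] ℝ := (-ω₂).compContinuousLinearMap (ContinuousLinearMap.snd ℝ E₁ E₂) with hP₂
  have hδ := castelnuovoSeveri_pos Φ₁ Φ₂ e f₁ f₂ h₁ h₂
  have heq : (torusIntegral (prodPeriod Φ₁ Φ₂) e ((ofRealForm T).wedge (ofRealForm T))).re *
      (torusIntegral (prodPeriod Φ₁ Φ₂) e ((ofRealForm P₁).wedge (ofRealForm P₂))).re =
      2 * (torusIntegral (prodPeriod Φ₁ Φ₂) e ((ofRealForm T).wedge (ofRealForm P₁))).re *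
        (torusIntegral (prodPeriod Φ₁ Φ₂) e ((ofRealForm T).wedge (ofRealForm P₂))).re := by
    rw [hT0, hT₁, hT₂, zero_mul, mul_zero]
  obtain ⟨c₁, c₂, hTc⟩ := (castelnuovoSeveri_eq_iff Φ₁ Φ₂ e f₁ f₂ h₁ h₂ hT).1 heq
  rw [← hP₁, ← hP₂] at hTc
  have h11 : (torusIntegral (prodPeriod Φ₁ Φ₂) e ((ofRealForm P₁).wedge (ofRealForm P₁))).re = 0 :=
    re_torusIntegral_comp_fst_wedge_comp_fst_eq_zero Φ₁ Φ₂ e f₁ _ _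
  have h22 : (torusIntegral (prodPeriod Φ₁ Φ₂) e ((ofRealForm P₂).wedge (ofRealForm P₂))).re = 0 :=
    re_torusIntegral_comp_snd_wedge_comp_snd_eq_zero Φ₁ Φ₂ e f₂ _ _
  have h21 : (torusIntegral (prodPeriod Φ₁ Φ₂) e ((ofRealForm P₂).wedge (ofRealForm P₁))).re =
      (torusIntegral (prodPeriod Φ₁ Φ₂) e ((ofRealForm P₁).wedge (ofRealForm P₂))).re :=
    re_torusIntegral_wedge_comm _ e P₂ P₁
  rw [hTc] at hT₁ hT₂
  simp only [re_torusIntegral_wedge_add_left, re_torusIntegral_wedge_smul_left, h11, h22, h21, mul_zero,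
    zero_add, add_zero] at hT₁ hT₂
  -- `hT₁ : c₂ * δ = 0`, `hT₂ : c₁ * δ = 0`
  have hc₂ : c₂ = 0 := (mul_eq_zero.1 hT₁).resolve_right hδ.ne'
  have hc₁ : c₁ = 0 := (mul_eq_zero.1 hT₂).resolve_right hδ.ne'
  rw [hTc, hc₁, hc₂, zero_smul, zero_smul, add_zero]

include f₁ f₂ in
/-- **The intersection form of `X₁ × X₂` is negative definite on `⟨F₁, F₂⟩^⊥`**: a non-zero real
`(1,1)`-class `T` with `T · F₁ = T · F₂ = 0` has `(T · T) < 0` (signature `(1, ρ - 1)` of the Néron–Severi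
lattice; `⟨F₁, F₂⟩` is a hyperbolic plane). [cite: Hartshorne1977, Ch. V Thm. 1.9 and Rem. 1.9.1]
[cite: Fulton1998, §16.1 Example 16.1.10 (a), (b) (p. 299)] -/
theorem re_torusIntegral_wedge_self_neg_of_orthogonal (h₁ : IsRiemannForm Φ₁ ω₁) (h₂ : IsRiemannForm Φ₂ ω₂)
    {T : (E₁ × E₂) [⋀^Fin 2]→L[ℝ] ℝ} (hT : ∀ u v : E₁ × E₂, T ![I • u, I • v] = T ![u, v]) (hT0 : T ≠ 0)
    (hT₁ : (torusIntegral (prodPeriod Φ₁ Φ₂) e ((ofRealForm T).wedge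
      (ofRealForm ((-ω₁).compContinuousLinearMap (ContinuousLinearMap.fst ℝ E₁ E₂))))).re = 0)
    (hT₂ : (torusIntegral (prodPeriod Φ₁ Φ₂) e ((ofRealForm T).wedge
      (ofRealForm ((-ω₂).compContinuousLinearMap (ContinuousLinearMap.snd ℝ E₁ E₂))))).re = 0) :
    (torusIntegral (prodPeriod Φ₁ Φ₂) e ((ofRealForm T).wedge (ofRealForm T))).re < 0 :=
  (re_torusIntegral_wedge_self_nonpos_of_orthogonal Φ₁ Φ₂ e f₁ f₂ h₁ h₂ hT hT₁ hT₂).lt_of_ne fun h0 ↦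
    hT0 (eq_zero_of_orthogonal_of_wedge_self_eq_zero Φ₁ Φ₂ e f₁ f₂ h₁ h₂ hT hT₁ hT₂ h0)

end NegativeDefinite

end ComplexTorus

end Literature.Geometry.Kaehler

end
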